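import Literature.NumberTheory.Transcendental.Roy2010.AdditiveSmallValueEstimates

/-!
# Pointwise transfer: few points of a progression where the gcd of a small family is large

Soloist file (informed mode, seat `solo-Schanuel-informed`, s180).  The first step of the
seat's THEOREMS AE-1τ / AE-2 (`paper/AE-note.md` §9, Lemma T′), CONDITIONAL on D. Roy's
pointwise transfer estimate [cite: Roy2010, Cor 3.2] carried as the displayed hypothesis
`(hR1 : Literature.NumberTheory.Transcendental.Roy2010.cor_3_2)` (a typed, unproved literature
fact; nothing is assumed about it beyond its statement).

`soloPT_few_bad_points`: let `ξ ≠ 0`, `K t ≤ n`, `r ≥ 2`, `P₀, …, P_{r-1} ∈ ℤ[X]` non-zero of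
degree `≤ n` and sup-norm `≤ H` (`H ≥ 1`) with `|P_i^{[j]}(cξ)| ≤ exp(-U)` for `1 ≤ c ≤ K`,
`j < t`; let `Q` be the primitive part of `gcd(P_i)` and
`E = {c ∈ [1, K] : |Q(cξ)| > exp(-X)}`.  If
`A ≤ U - X - 4 n log(2 + K‖ξ‖) + n log min(1, ‖ξ‖)` then `#E · t · A ≤ 10 n² + 2 n log H`
(Cor 3.2 applied ON THE SET `E` itself, where the lower bound `|Q(cξ)| > exp(-X)` competes
with the upper bound; the capacity term is bounded using `|cξ - c'ξ| ≥ ‖ξ‖`).  Corollaries: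
`soloPT_few_bad_points_card` (`200 · #E ≤ K` under one more explicit inequality) and
`soloPT_small_off_bad` (`|Q(cξ)| ≤ exp(-X)` off `E`, by definition).

What this is NOT.  Conditional on [cite: Roy2010, Cor 3.2] as displayed; no small value
estimate is proved here and nothing bears on `Literature.Periods.SchanuelConjecture` (the
seat's verdict, no path, is unchanged).  Mathlib and the typed statement file only; no
definitions; axioms the standard three.
-/

namespace Summit.Schanuel.Schanuel.Theorems

open Polynomial Finset
open Literature.NumberTheory.Transcendental.Roy2010 (cMax deltaCap cor_3_2)

/-- The points `cξ`, `c ∈ E ⊆ ℕ`, are `#E` distinct complex numbers when `ξ ≠ 0`. -/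
theorem soloPT_card_image {ξ : ℂ} (hξ0 : ξ ≠ 0) (E : Finset ℕ) :
    #(E.image fun c : ℕ => (c : ℂ) * ξ) = #E :=
  Finset.card_image_of_injective _ fun a b h => by
    have h' : (a : ℂ) = b := mul_right_cancel₀ hξ0 h
    exact_mod_cast h'

/-- `cMax {cξ : c ∈ E} ≤ K‖ξ‖` when every `c ∈ E` is `≤ K`. -/
theorem soloPT_cMax_image_le (ξ : ℂ) {E : Finset ℕ} {K : ℕ} (hE : ∀ c ∈ E, c ≤ K) :
    cMax (E.image fun c : ℕ => (c : ℂ) * ξ) ≤ K * ‖ξ‖ := by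
  unfold cMax
  have h : ((E.image fun c : ℕ => (c : ℂ) * ξ).sup fun z => ‖z‖₊) ≤ (K : NNReal) * ‖ξ‖₊ := by
    apply Finset.sup_le
    intro z hz
    obtain ⟨c, hc, rfl⟩ := Finset.mem_image.mp hz
    rw [nnnorm_mul]
    have hc' : ‖(c : ℂ)‖₊ = (c : NNReal) := by
      apply NNReal.eq
      simp
    rw [hc']
    exact mul_le_mul_left (by exact_mod_cast hE c hc) _
  have h' := NNReal.coe_le_coe.mpr h
  simpa [NNReal.coe_mul, coe_nnnorm] using h'

/-- `0 ≤ cMax F`. -/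
theorem soloPT_cMax_nonneg (F : Finset ℂ) : 0 ≤ cMax F := by
  unfold cMax
  exact NNReal.zero_le_coe

/-- The capacity term of the points `cξ`, `c ∈ E`: `deltaCap ≥ min(1, ‖ξ‖)^{#E²}`, because
two distinct points are `≥ ‖ξ‖` apart and there are `≤ #E²` ordered pairs. -/
theorem soloPT_pow_le_deltaCap_image {ξ : ℂ} (hξ0 : ξ ≠ 0) (E : Finset ℕ) :
    (min 1 ‖ξ‖) ^ (#E ^ 2) ≤ deltaCap (E.image fun c : ℕ => (c : ℂ) * ξ) := by
  unfold deltaCap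
  set F := E.image fun c : ℕ => (c : ℂ) * ξ with hF
  have hm0 : 0 < min 1 ‖ξ‖ := lt_min one_pos (norm_pos_iff.mpr hξ0)
  have hm1 : min 1 ‖ξ‖ ≤ 1 := min_le_left _ _
  have hfac : ∀ p ∈ F.offDiag, min 1 ‖ξ‖ ≤ Real.sqrt ‖p.1 - p.2‖ := by
    intro p hp
    rw [Finset.mem_offDiag] at hp
    obtain ⟨h1, h2, h12⟩ := hp
    obtain ⟨a, -, ha⟩ := Finset.mem_image.mp h1
    obtain ⟨b, -, hb⟩ := Finset.mem_image.mp h2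
    have hab : a ≠ b := by
      rintro rfl
      exact h12 (ha.symm.trans hb)
    have hnorm : ‖ξ‖ ≤ ‖p.1 - p.2‖ := by
      rw [← ha, ← hb, ← sub_mul, norm_mul]
      have h1' : (1 : ℝ) ≤ ‖((a : ℂ) - (b : ℂ))‖ := by
        have : ((a : ℂ) - (b : ℂ)) = ((a - b : ℤ) : ℂ) := by push_cast; ring
        rw [this, Complex.norm_intCast]
        have hne : (a : ℤ) - b ≠ 0 := by omega
        exact_mod_cast Int.one_le_abs hne
      exact le_mul_of_one_le_left (norm_nonneg _) h1'
    rw [Real.le_sqrt' hm0]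
    calc (min 1 ‖ξ‖) ^ 2 ≤ min 1 ‖ξ‖ := by nlinarith
      _ ≤ ‖ξ‖ := min_le_right _ _
      _ ≤ ‖p.1 - p.2‖ := hnorm
  have hcard : #F.offDiag ≤ #E ^ 2 := by
    rw [Finset.offDiag_card, hF, soloPT_card_image hξ0, sq]
    exact Nat.sub_le _ _
  calc (min 1 ‖ξ‖) ^ (#E ^ 2) ≤ (min 1 ‖ξ‖) ^ #F.offDiag :=
        pow_le_pow_of_le_one hm0.le hm1 hcard
    _ = ∏ _p ∈ F.offDiag, min 1 ‖ξ‖ := by rw [Finset.prod_const]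
    _ ≤ ∏ p ∈ F.offDiag, Real.sqrt ‖p.1 - p.2‖ :=
        Finset.prod_le_prod (fun _ _ => hm0.le) hfac

/-- **Few bad points (AE-note §9, Lemma T′; conditional on [Roy2010, Cor 3.2]).**  See the
module docstring for the statement in words. -/
theorem soloPT_few_bad_points (hR1 : cor_3_2) {ξ : ℂ} (hξ0 : ξ ≠ 0) {n K t r : ℕ}
    (hn : 0 < n) (ht : 0 < t) (hKt : K * t ≤ n) (hr : 2 ≤ r) {P : Fin r → ℤ[X]}
    (hP0 : ∀ i, P i ≠ 0) (hPdeg : ∀ i, (P i).natDegree ≤ n) {H : ℝ} (hH1 : 1 ≤ H)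
    (hPH : ∀ i, (P i).supNorm ≤ H) {U X A : ℝ}
    (hval : ∀ c ∈ Icc 1 K, ∀ i, ∀ j : ℕ, j < t →
      ‖aeval ((c : ℂ) * ξ) (hasseDeriv j (P i))‖ ≤ Real.exp (-U))
    (hA : A ≤ U - X - 4 * n * Real.log (2 + K * ‖ξ‖) + n * Real.log (min 1 ‖ξ‖)) :
    (#((Icc 1 K).filter fun c : ℕ => Real.exp (-X) <
        ‖aeval ((c : ℂ) * ξ) ((univ : Finset (Fin r)).gcd P).primPart‖) : ℝ) * (t * A) ≤
      10 * (n : ℝ) ^ 2 + 2 * n * Real.log H := by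
  classical
  set Q := ((univ : Finset (Fin r)).gcd P).primPart with hQ
  set Eb := (Icc 1 K).filter fun c : ℕ => Real.exp (-X) < ‖aeval ((c : ℂ) * ξ) Q‖ with hEb
  have hlogH : 0 ≤ Real.log H := Real.log_nonneg hH1
  have hH0 : 0 < H := by linarith
  have hn0 : (0 : ℝ) < n := by exact_mod_cast hn
  rcases Nat.eq_zero_or_pos #Eb with hs0 | hs0
  · rw [hs0, Nat.cast_zero, zero_mul]
    positivity
  set s := #Eb with hs
  set F := Eb.image fun c : ℕ => (c : ℂ) * ξ with hF
  have hFcard : #F = s := by rw [hF, soloPT_card_image hξ0]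
  have hEbK : ∀ c ∈ Eb, c ≤ K := fun c hc =>
    (Finset.mem_Icc.mp (Finset.mem_filter.mp hc).1).2
  have hsK : s ≤ K := by
    calc s = #Eb := rfl
      _ ≤ #(Icc 1 K) := Finset.card_le_card (Finset.filter_subset _ _)
      _ = K := by simp
  have hst : s * t ≤ n := (Nat.mul_le_mul_right t hsK).trans hKt
  -- Roy's Corollary 3.2 on `F` with the constant value bound `exp(-U)`
  have hmain := hR1 n s t hn hs0 ht hst F hFcard r hr P hP0 hPdeg H hPH
    (fun _ => Real.exp (-U))
    (fun z hz i j hj => by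
      obtain ⟨c, hc, rfl⟩ := Finset.mem_image.mp hz
      exact hval c (Finset.mem_filter.mp hc).1 i j hj)
  -- lower bound for the left side
  have hlow : Real.exp (-X) ^ (t * s) ≤ ∏ z ∈ F, ‖aeval z Q‖ ^ t := by
    have h1 : ∏ z ∈ F, Real.exp (-X) ^ t ≤ ∏ z ∈ F, ‖aeval z Q‖ ^ t := by
      apply Finset.prod_le_prod (fun _ _ => by positivity)
      intro z hz
      obtain ⟨c, hc, rfl⟩ := Finset.mem_image.mp hz
      exact pow_le_pow_left₀ (Real.exp_pos _).le (le_of_lt (Finset.mem_filter.mp hc).2) t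
    rw [Finset.prod_const, hFcard, ← pow_mul] at h1
    exact h1
  -- upper bound for the constant `c₁`
  set ℓ₂ := Real.log (2 + K * ‖ξ‖) with hℓ₂
  set ℓ₀ := -Real.log (min 1 ‖ξ‖) with hℓ₀
  have hm0 : 0 < min 1 ‖ξ‖ := lt_min one_pos (norm_pos_iff.mpr hξ0)
  have hm1 : min 1 ‖ξ‖ ≤ 1 := min_le_left _ _
  have hℓ₀0 : 0 ≤ ℓ₀ := by
    rw [hℓ₀]
    linarith [Real.log_nonpos hm0.le hm1]
  have hexpℓ₀ : Real.exp (-ℓ₀) = min 1 ‖ξ‖ := by rw [hℓ₀, neg_neg, Real.exp_log hm0]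
  have hexpℓ₂ : Real.exp ℓ₂ = 2 + K * ‖ξ‖ := by rw [hℓ₂, Real.exp_log (by positivity)]
  have hcmax : cMax F ≤ K * ‖ξ‖ := soloPT_cMax_image_le ξ hEbK
  have hcmax0 : 0 ≤ cMax F := soloPT_cMax_nonneg F
  have hδ : (min 1 ‖ξ‖) ^ (s ^ 2) ≤ deltaCap F := soloPT_pow_le_deltaCap_image hξ0 Eb
  have hδ0 : 0 < deltaCap F := lt_of_lt_of_le (by positivity) hδ
  have hc₁ : Literature.NumberTheory.Transcendental.Roy2010.c₁ n s t F ≤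
      Real.exp (7 * (n : ℝ) ^ 2 + (4 * n * s * t : ℕ) * ℓ₂ + (s ^ 2 * t ^ 2 : ℕ) * ℓ₀) := by
    unfold Literature.NumberTheory.Transcendental.Roy2010.c₁
    rw [div_le_iff₀ (pow_pos hδ0 _)]
    have h2 : (2 + cMax F) ^ (4 * n * s * t) ≤ Real.exp ℓ₂ ^ (4 * n * s * t) := by
      apply pow_le_pow_left₀ (by linarith)
      rw [hexpℓ₂]
      linarith
    have h3 : Real.exp (-ℓ₀) ^ (s ^ 2 * t ^ 2) ≤ deltaCap F ^ (t ^ 2) := by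
      rw [pow_mul, hexpℓ₀]
      exact pow_le_pow_left₀ (by positivity) hδ _
    calc Real.exp (7 * (n : ℝ) ^ 2) * (2 + cMax F) ^ (4 * n * s * t)
        ≤ Real.exp (7 * (n : ℝ) ^ 2) * Real.exp ℓ₂ ^ (4 * n * s * t) := by gcongr
      _ = Real.exp (7 * (n : ℝ) ^ 2 + (4 * n * s * t : ℕ) * ℓ₂ + (s ^ 2 * t ^ 2 : ℕ) * ℓ₀) *
            Real.exp (-ℓ₀) ^ (s ^ 2 * t ^ 2) := by
          rw [← Real.exp_nat_mul, ← Real.exp_nat_mul, ← Real.exp_add, ← Real.exp_add]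
          congr 1
          ring
      _ ≤ _ := by gcongr
  -- the upper bound of Corollary 3.2 in exponential form
  have hHpow : H ^ (2 * n) = Real.exp ((2 * n : ℕ) * Real.log H) := by
    rw [Real.exp_nat_mul, Real.exp_log hH0]
  have hVprod : ∏ _z ∈ F, Real.exp (-U) ^ t = Real.exp ((t * s : ℕ) * -U) := by
    rw [Finset.prod_const, hFcard, ← pow_mul, Real.exp_nat_mul]
  have hXpow : Real.exp (-X) ^ (t * s) = Real.exp ((t * s : ℕ) * -X) := by
    rw [Real.exp_nat_mul]
  have hc₁0 : 0 ≤ Literature.NumberTheory.Transcendental.Roy2010.c₁ n s t F := by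
    unfold Literature.NumberTheory.Transcendental.Roy2010.c₁
    positivity
  have hup : ∏ z ∈ F, ‖aeval z Q‖ ^ t ≤
      Real.exp (3 * (n : ℝ) ^ 2 + (7 * (n : ℝ) ^ 2 + (4 * n * s * t : ℕ) * ℓ₂ +
        (s ^ 2 * t ^ 2 : ℕ) * ℓ₀) + (2 * n : ℕ) * Real.log H + (t * s : ℕ) * -U) := by
    refine hmain.trans ?_
    rw [hHpow, hVprod, Real.exp_add, Real.exp_add, Real.exp_add]
    gcongr
  have hcmp := Real.exp_le_exp.mp ((hXpow ▸ hlow).trans hup)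
  push_cast at hcmp
  -- linear bookkeeping
  have hst' : ((s : ℝ) * t) * ((s : ℝ) * t) ≤ (n : ℝ) * ((s : ℝ) * t) := by
    have h' : ((s * t * (s * t) : ℕ) : ℝ) ≤ ((n * (s * t) : ℕ) : ℝ) := by
      exact_mod_cast Nat.mul_le_mul_right (s * t) hst
    push_cast at h'
    linarith
  have hq : (s : ℝ) ^ 2 * (t : ℝ) ^ 2 * ℓ₀ ≤ (n : ℝ) * ((s : ℝ) * t) * ℓ₀ := by
    have := mul_le_mul_of_nonneg_right hst' hℓ₀0
    calc (s : ℝ) ^ 2 * (t : ℝ) ^ 2 * ℓ₀ = ((s : ℝ) * t) * ((s : ℝ) * t) * ℓ₀ := by ring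
      _ ≤ _ := this
  have hst0 : (0 : ℝ) ≤ (s : ℝ) * t := by positivity
  have hA' : ((s : ℝ) * t) * A ≤
      ((s : ℝ) * t) * (U - X - 4 * n * ℓ₂ + n * Real.log (min 1 ‖ξ‖)) :=
    mul_le_mul_of_nonneg_left hA hst0
  have hlogm : Real.log (min 1 ‖ξ‖) = -ℓ₀ := by rw [hℓ₀, neg_neg]
  rw [hlogm] at hA'
  have : (#Eb : ℝ) * (t * A) = ((s : ℝ) * t) * A := by rw [hs]; ring
  rw [this]
  nlinarith

/-- Corollary: with `200 (10 n² + 2 n log H) ≤ K · t · A`, at most `K / 200` bad points. -/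
theorem soloPT_few_bad_points_card (hR1 : cor_3_2) {ξ : ℂ} (hξ0 : ξ ≠ 0) {n K t r : ℕ}
    (hn : 0 < n) (ht : 0 < t) (hKt : K * t ≤ n) (hr : 2 ≤ r) {P : Fin r → ℤ[X]}
    (hP0 : ∀ i, P i ≠ 0) (hPdeg : ∀ i, (P i).natDegree ≤ n) {H : ℝ} (hH1 : 1 ≤ H)
    (hPH : ∀ i, (P i).supNorm ≤ H) {U X A : ℝ}
    (hval : ∀ c ∈ Icc 1 K, ∀ i, ∀ j : ℕ, j < t →
      ‖aeval ((c : ℂ) * ξ) (hasseDeriv j (P i))‖ ≤ Real.exp (-U))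
    (hA0 : 0 < A)
    (hA : A ≤ U - X - 4 * n * Real.log (2 + K * ‖ξ‖) + n * Real.log (min 1 ‖ξ‖))
    (hbud : 200 * (10 * (n : ℝ) ^ 2 + 2 * n * Real.log H) ≤ K * (t * A)) :
    200 * #((Icc 1 K).filter fun c : ℕ => Real.exp (-X) <
        ‖aeval ((c : ℂ) * ξ) ((univ : Finset (Fin r)).gcd P).primPart‖) ≤ K := by
  have h := soloPT_few_bad_points hR1 hξ0 hn ht hKt hr hP0 hPdeg hH1 hPH hval hA
  have htA : 0 < (t : ℝ) * A := by
    have : (0 : ℝ) < t := by exact_mod_cast ht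
    positivity
  have h' : ((200 * #((Icc 1 K).filter fun c : ℕ => Real.exp (-X) <
      ‖aeval ((c : ℂ) * ξ) ((univ : Finset (Fin r)).gcd P).primPart‖) : ℕ) : ℝ) * (t * A) ≤
      (K : ℝ) * (t * A) := by
    push_cast
    nlinarith
  exact_mod_cast le_of_mul_le_mul_right h' htA

/-- Off the bad set the gcd is small (by definition). -/
theorem soloPT_small_off_bad (ξ : ℂ) (K : ℕ) {r : ℕ} (P : Fin r → ℤ[X]) (X : ℝ) :
    ∀ c ∈ Icc 1 K \ (Icc 1 K).filter (fun c : ℕ => Real.exp (-X) <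
        ‖aeval ((c : ℂ) * ξ) ((univ : Finset (Fin r)).gcd P).primPart‖),
      ‖aeval ((c : ℂ) * ξ) ((univ : Finset (Fin r)).gcd P).primPart‖ ≤ Real.exp (-X) := by
  intro c hc
  rw [Finset.mem_sdiff, Finset.mem_filter, not_and, not_lt] at hc
  exact hc.2 hc.1

end Summit.Schanuel.Schanuel.Theorems
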